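import Summits.PneNP.PneNP.Theses.RootDecompMcspDial
import Summits.PneNP.PneNP.Theorems.SoloBlindAnchor
import Summits.PneNP.PneNP.Theorems.SzkEntropyPhCollapseStandalone
import Literature.Barriers.PneNP.MCSPHardnessObstructionsPadding
import Literature.Computability.Complexity.NPSubsetNTIME
import Literature.Computability.Complexity.DiagMachine
import Literature.Computability.Complexity.NPClosureProofs
import Literature.Computability.Complexity.StringCopy
import Literature.Computability.Complexity.BranchingFn

/-!
# `RootDecompMcspDial.McspPHLift` (stmt-PneNP-27848) — the decided lower edge of the MCSP succinct-hardness dial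

Node N11 of the decomp-pnenp root-decomposition cell (route `route-PneNP-RootDecompMcspDial`, lens-3 g4
«McspSuccinctDial») cuts the root along the succinctness dial of NP-hardness of MCSP: `HardVia 𝒟` says
that MCSP is NP-hard for sparse NP languages under polynomial-time reductions whose padded bit language
and padded witness-verifier language lie in `𝒟`.  The B-side aside at the notch `𝒟 = PH` is a THEOREM:
PH-succinct NP-hardness of MCSP for sparse NP implies `P ≠ NP` — Murray–Williams 2017 Thm 4.1 read with
`P` in place of `EXP ⊆ P/poly`: if the succinctness class collapses to `P`, a `HardVia` reduction would put
`NTIME(2ⁿ)` (hence, by padding, `NEXP`) inside `NP`, contradicting the nondeterministic time hierarchy;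
and under `NP ⊆ P` the polynomial hierarchy collapses to `P` (tree theorem
`szkEntropy_phCollapse_standalone`).  Port of the lens kernel `hardnessLift_PH` /
`not_hardVia_of_subset_P` (HOME/decomp-pnenp-lens-3/McspSuccinctDial.lean sha256 1ee0b32c…) as private
lemmas over the tree's Murray–Williams modules; census tribunal batch 1 (TRIB-PNENP-ROOTDECOMP-1) and
the cell's cycle-2 order list the item as provable-now.  0 sorry.
[cite: MurrayWilliams2017, Thm 1.8, Thm 4.1]
-/

namespace Summit.PneNP.PneNP.Theorems

open _root_.Computability Literature.Computability.Complexity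
  Literature.Computability.Complexity.Nondeterministic Literature.Computability.MetaComplexity
  Literature.Computability.MetaComplexity.MCSPVerif
  Literature.Barriers.PneNP Literature.Barriers.PneNP.KarpAssembly
open scoped Literature.Computability.Complexity.Notation

/-- Murray–Williams Thm 4.1 with `P` for `EXP ⊆ P/poly` (port of the lens lemma
`NTIME_two_pow_subset_NP_of_hardVia`): a `HardVia 𝒟` reduction with `𝒟 ⊆ P` puts `NTIME(2ⁿ)` in `NP`
(sparse padding of an `NTIME(2ⁿ)` language, the projection form of the reduction, and a `polyExists`
verifier). -/
private theorem mcspPH_NTIME_two_pow_subset_NP {𝒟 : Set (Language Bool)} (h𝒟 : 𝒟 ⊆ Classes.P)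
    (hH : ∀ L ∈ NP, IsSparseLanguage L → ∃ f : List Bool → List Bool, f ∈ FP ∧
      (∀ x, x ∈ L ↔ f x ∈ MCSP) ∧ (mapFstFn (f ∘ lpad 1) ⁻¹' BitLang : Language Bool) ∈ 𝒟 ∧
      (mapFstFn (f ∘ lpad 1) ⁻¹' Ver : Language Bool) ∈ 𝒟) :
    NTIME (fun n => 2 ^ n) ⊆ NP := by
  intro L hL
  obtain ⟨Lp, hLpNP, hsparse, hpad⟩ := exists_sparse_pad_mem_NP hL
  obtain ⟨f, hf, hred, hBits, hVer⟩ := hH Lp hLpNP hsparse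
  have hf' : f ∘ (lpad 1 ∘ logTruncFn) ∈ FP := comp_mem_FP hf lpad_comp_logTruncFn_mem_FP
  have hred' : ∀ w, w ∈ logTruncLang L ↔ (f ∘ (lpad 1 ∘ logTruncFn)) w ∈ MCSP := fun w => by
    change logTruncFn w ∈ L ↔ f (lpad 1 (logTruncFn w)) ∈ MCSP
    rw [hpad, hred]
  have hfun : (f ∘ (lpad 1 ∘ logTruncFn)) ∘ lpad 1 = f ∘ lpad 1 :=
    funext fun x => by simp only [Function.comp_apply, logTruncFn_lpad le_rfl]
  have hB : (mapFstFn (f ∘ lpad 1) ⁻¹' BitLang : Language Bool) ∈ PPoly :=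
    P_subset_PPoly_holds (h𝒟 hBits)
  have hV : (mapFstFn (f ∘ lpad 1) ⁻¹' Ver : Language Bool) ∈ Classes.P := h𝒟 hVer
  obtain ⟨r, hr⟩ := exists_projection_form (L := L) le_rfl hf' hred' (by rw [hfun]; exact hB)
  rw [hfun] at hr
  have hmem : L ∈ polyExists Classes.P := ⟨_, hV, r, hr⟩
  exact hmem

/-- … hence `NEXP ⊆ NP` by padding (port of the lens lemma `NEXP_subset_NP_of_hardVia`). -/
private theorem mcspPH_NEXP_subset_NP {𝒟 : Set (Language Bool)} (h𝒟 : 𝒟 ⊆ Classes.P)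
    (hH : ∀ L ∈ NP, IsSparseLanguage L → ∃ f : List Bool → List Bool, f ∈ FP ∧
      (∀ x, x ∈ L ↔ f x ∈ MCSP) ∧ (mapFstFn (f ∘ lpad 1) ⁻¹' BitLang : Language Bool) ∈ 𝒟 ∧
      (mapFstFn (f ∘ lpad 1) ⁻¹' Ver : Language Bool) ∈ 𝒟) :
    NEXP ⊆ NP := by
  intro L hL
  simp only [NEXP, Set.mem_iUnion] at hL
  obtain ⟨k, hk⟩ := hL
  exact mem_NP_of_karpReducible_holds (karpReducible_padPre k L)
    (mcspPH_NTIME_two_pow_subset_NP h𝒟 hH (padPre_mem_NTIME_two_pow hk))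

/-- UNCONDITIONAL: no `HardVia 𝒟` reduction exists for a succinctness class `𝒟 ⊆ P` (nondeterministic
time hierarchy; port of the lens lemma `not_hardVia_of_subset_P`). -/
private theorem mcspPH_not_hardVia_of_subset_P {𝒟 : Set (Language Bool)} (h𝒟 : 𝒟 ⊆ Classes.P) :
    ¬ (∀ L ∈ NP, IsSparseLanguage L → ∃ f : List Bool → List Bool, f ∈ FP ∧
      (∀ x, x ∈ L ↔ f x ∈ MCSP) ∧ (mapFstFn (f ∘ lpad 1) ⁻¹' BitLang : Language Bool) ∈ 𝒟 ∧
      (mapFstFn (f ∘ lpad 1) ⁻¹' Ver : Language Bool) ∈ 𝒟) :=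
  fun hH => not_NEXP_subset_NP_of_ntime_hierarchy Diag.ntime_hierarchy_holds NP_subset_NTIME_two_pow
    (mcspPH_NEXP_subset_NP h𝒟 hH)

/-- `¬ PneNP → NP ⊆ P`, through the tree's Cook–Clay anchor `SoloBlind.pneNP_iff_P_ne_NP`. -/
private theorem mcspPH_NP_subset_P_of_not_pneNP (hS : ¬ PneNP) : NP ⊆ Classes.P := by
  have h : Classes.P = NP := by
    by_contra hne
    exact hS (SoloBlind.pneNP_iff_P_ne_NP.2 hne)
  exact h.symm.subset

/-- The decided lower edge of the MCSP succinct-hardness dial (stmt-PneNP-27848, `McspPHLift`):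
PH-succinct NP-hardness of MCSP for sparse NP languages implies `P ≠ NP`.  If `P = NP` then `PH = P`
(`szkEntropy_phCollapse_standalone`) and no `P`-succinct hardness reduction exists
(`mcspPH_not_hardVia_of_subset_P`, Murray–Williams Thm 4.1 + nondeterministic time hierarchy).  Port
of the lens-3 g4 kernel `hardnessLift_PH` (decomp-pnenp cell, 2026-08-30).
[cite: MurrayWilliams2017, Thm 4.1] -/
theorem mcspPHLift_proof :
    Summit.PneNP.PneNP.Theses.RootDecompMcspDial.McspPHLift := by
  unfold Summit.PneNP.PneNP.Theses.RootDecompMcspDial.McspPHLift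
  intro hH
  by_contra hS
  exact mcspPH_not_hardVia_of_subset_P
    (szkEntropy_phCollapse_standalone (mcspPH_NP_subset_P_of_not_pneNP hS)) hH

end Summit.PneNP.PneNP.Theorems
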